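import Mathlib.Algebra.Algebra.Subalgebra.Basic
import Literature.Algebra.Lie.LefschetzModule
import HarnessLib

/-!
# The `𝔰𝔩₂`-partner of a Lefschetz operator is a polynomial in `e` and any string-reversing operator (Kleiman 1968, 1.4.4; André 1996, Prop. 1.2)

Topic `Literature/Algebra/Lie` (namespace `Literature.Algebra.Lie`).  Sequel of `LefschetzModule.lean` (the graded
Jacobson–Morozov lemma: for a Lefschetz operator `e` of degree `2` on a finite-dimensional `ℤ`-graded `(M, h)` over a
field of characteristic `0`, the partner `f = HasLefschetzProperty.dual` with `(e, h, f)` an `𝔰𝔩₂`-triple, and André's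
string formula `dual_apply_pow_primitive`).  This file proves the ABSTRACT form of Kleiman's 1.4.4 / André's
Prop. 1.2 "`ℚ[L, *_L] = ℚ[L, *_L L *_L] = ℚ[L, ᶜΛ]`" in the direction the consumers need: **`f` lies in the subalgebra
of `End M` generated by `e` and `s e s`, for ANY operator `s` reversing the `𝔰𝔩₂`-strings** (`s (eʲ p) = e^{k-j} p`
for `p` primitive of weight `-k` — the defining property of the Lefschetz involution `*_L`, André §1.1:
"`*_L x = Σ L^{d-j+k} x_{j-2k}`").  DEFINITIONS WITH BODIES and PROVED theorems only (no named fact, no `sorry`;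
D-0026 net debt `0`).

## Sources, VERBATIM

Y. André, *Pour une théorie inconditionnelle des motifs*, Publ. Math. IHÉS **83** (1996) 5–49 (held
`paper:doi-10-1007-bf02698643`), §1.1 (p. 10 / PDF p. 7): "si `x = Σ Lᵏ x_{j-2k}` est la décomposition de Lefschetz de
`x ∈ Hʲ(X)`, alors `ᶜΛ x = Σ k(d - j + k + 1) L^{k-1} x_{j-2k}` […] On définit aussi les involutions de Lefschetz et de
Hodge respectivement par les formules : `*_L x = Σ L^{d-j+k} x_{j-2k}`"; Prop. 1.2 (p. 11): "Les sous-algèbres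
`ℚ[L, *_L]`, `ℚ[L, *_H]`, `ℚ[L, *_L L *_L]`, `ℚ[L, ᶜΛ]` de `End H*(X)` sont égales et contiennent les projecteurs de
Künneth. […] *Preuve.* — Pour la première assertion, on renvoie à [Kl68] 1.4.4, 1.4.5."
S. L. Kleiman, *Algebraic cycles and the Weil conjectures*, in: Dix exposés sur la cohomologie des schémas (1968),
§1.4, 1.4.4 — as cited by André, loc. cit., and by J. S. Milne, Duke Math. J. 96 (1999) p. 665: "Consequently, all
elements of the `ℚ`-algebra `ℚ[L, Λ]` are Lefschetz. Since this algebra contains `ᶜΛ` and `∗` (Kleiman 1968, 1.4.4)".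

## Rendering (dictionary, continuing `LefschetzModule.lean`)

* `(M, h)`, `M_k = degreeSpace h k`, `e` with `L : HasLefschetzProperty h e`, `P_{-k} = primitiveSpace h e k`,
  `f = L.dual hgr` as there.  A STRING is `p, e p, …, eᵏ p` for `p ∈ P_{-k}`.
* "`*_L`" is abstracted to ANY `s : End M` with `IsStringReversal h e s`: `s (eʲ p) = e^{k-j} p` (`p ∈ P_{-k}`,
  `j ≤ k`).  The concrete `*_L` of a smooth projective variety has this property (sequel file in
  `AlgebraicGeometry/HodgeTheory`); the criterion `isStringReversal_of_apply_eq` reduces it to the two defining clauses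
  of André's `*_L` ("l'isomorphisme de Lefschetz ou son inverse"): `s = eᵏ` on `M_{-k}` and `s eᵏ = id` on `M_{-k}`.
* "`ᶜΛ ∈ ℚ[L, *_L L *_L]`": `L.dual hgr ∈ Algebra.adjoin K {e, s * e * s}` (`dual_mem_adjoin_conj`), hence
  `∈ Algebra.adjoin K {e, s}` (`dual_mem_adjoin`).

## Contents (all proved)

* §1 strings: `pow_apply_pow_primitive_of_lt` (`eⁱ eʲ p = 0` past the top), the span of all strings is everything
  (`span_stringSet_eq_top`: below degree `0` by the two-term primitive decomposition `M_{-k} = P_{-k} ⊕ e M_{-k-2}` of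
  `LefschetzModule`, iterated — `M_{-k} = 0` for `k ≥ dim M`; above by the Lefschetz bijections `eᵏ : M_{-k} ≅ M_k`),
  and the extensionality principle `linearMap_ext_of_strings`.
* §2 `IsStringReversal` and the criterion `isStringReversal_of_apply_eq`.
* §3 the operators on strings: `N = s e s` lowers a string by one step and kills its bottom
  (`conj_apply_pow_primitive`), `eⁱ Nⁱ` / `Nᵗ eᵗ` are the projectors onto the positions `≥ i` from the bottom /
  `≥ t` from the top (`pow_mul_conj_pow_apply`, `conj_pow_mul_pow_apply`), so their first differences cut out one
  position (`posProj_apply`, `coposProj_apply`).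
* §4 **Kleiman's polynomial** `kleimanDual e s D = Σ_{1 ≤ i ≤ D, t ≤ D} i(t+1) · N ∘ (eⁱNⁱ − eⁱ⁺¹Nⁱ⁺¹) ∘ (Nᵗeᵗ − Nᵗ⁺¹eᵗ⁺¹)`
  (on `eʲ p`, `p ∈ P_{-k}`: `j(k-j+1) e^{j-1} p` — André's coefficient), `kleimanDual_mem_adjoin`, and the
  identification **`dual_eq_kleimanDual`** (`D = dim M`; André's formula `dual_apply_pow_primitive` on strings +
  `linearMap_ext_of_strings`), whence **`dual_mem_adjoin_conj`**, **`dual_mem_adjoin`**.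

## SCOPE (not formalised)

The reverse inclusions `*_L ∈ ℚ[L, ᶜΛ]`, the Künneth projectors, `*_H`, and the matrix-algebra structure of
`ℚ[L, ᶜΛ]` (André Prop. 1.2, second assertion) are not formalised here.
-/

noncomputable section

namespace Literature.Algebra.Lie

open Module Function Set
open HasLefschetzProperty (primitiveSpace mem_primitiveSpace_iff)

variable {K : Type*} [Field K] {M : Type*} [AddCommGroup M] [Module K M] {h e : Module.End K M}

/-! ### §1 Strings span -/

/-- Past the top of a string everything vanishes: `eⁱ (eʲ p) = 0` for `p ∈ P_{-k}` and `i + j > k`.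
[cite: Andre1996Motifs, §1.1 (Lefschetz decomposition: L^{d-i+1} x_i = 0 for x_i primitive)] -/
theorem pow_apply_pow_primitive_of_lt {k : ℕ} {p : M} (hp : p ∈ primitiveSpace h e k) {i j : ℕ}
    (hij : k < i + j) : (e ^ i) ((e ^ j) p) = 0 := by
  obtain ⟨c, hc⟩ := Nat.exists_eq_add_of_lt hij
  rw [← Module.End.mul_apply, ← pow_add, hc, show k + c + 1 = c + (k + 1) by ring, pow_add,
    Module.End.mul_apply, (mem_primitiveSpace_iff.1 hp).2, map_zero]

variable (h e) in
/-- The set of all string vectors `eʲ p`, `p ∈ P_{-k}`, `j ≤ k`. [cite: Andre1996Motifs, §1.1 (the Lefschetz components Lᵏ x_{j-2k})] -/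
def stringSet : Set M :=
  {x | ∃ (k : ℕ) (p : M) (j : ℕ), p ∈ primitiveSpace h e k ∧ j ≤ k ∧ x = (e ^ j) p}

/-- A primitive vector is a string vector (position `0`). [cite: Andre1996Motifs, §1.1] -/
theorem mem_stringSet_of_mem_primitiveSpace {k : ℕ} {p : M} (hp : p ∈ primitiveSpace h e k) :
    p ∈ stringSet h e :=
  ⟨k, p, 0, hp, Nat.zero_le _, by rw [pow_zero, Module.End.one_apply]⟩

/-- `e` maps the span of the strings into itself (`e (eʲ p) = eʲ⁺¹ p`, zero past the top).
[cite: Andre1996Motifs, §1.1] -/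
theorem apply_mem_span_stringSet {x : M} (hx : x ∈ Submodule.span K (stringSet h e)) :
    e x ∈ Submodule.span K (stringSet h e) := by
  induction hx using Submodule.span_induction with
  | mem x hx =>
    obtain ⟨k, p, j, hp, hj, rfl⟩ := hx
    rcases hj.lt_or_eq with hjk | rfl
    · exact Submodule.subset_span ⟨k, p, j + 1, hp, hjk, by rw [pow_succ', Module.End.mul_apply]⟩
    · rw [← Module.End.mul_apply, ← pow_succ', (mem_primitiveSpace_iff.1 hp).2]
      exact Submodule.zero_mem _
  | zero => rw [map_zero]; exact Submodule.zero_mem _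
  | add x y _ _ hx hy => rw [map_add]; exact Submodule.add_mem _ hx hy
  | smul c x _ hx => rw [map_smul]; exact Submodule.smul_mem _ c hx

/-- … hence so does every power `eⁿ`. [cite: Andre1996Motifs, §1.1] -/
theorem pow_apply_mem_span_stringSet (n : ℕ) {x : M} (hx : x ∈ Submodule.span K (stringSet h e)) :
    (e ^ n) x ∈ Submodule.span K (stringSet h e) := by
  induction n with
  | zero => rwa [pow_zero, Module.End.one_apply]
  | succ n ih => rw [pow_succ', Module.End.mul_apply]; exact apply_mem_span_stringSet ih

section Span

variable [CharZero K] [FiniteDimensional K M]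

/-- The non-positive degree parts lie in the span of the strings: `M_{-k} = P_{-k} + e M_{-k-2}`
(`exists_primitive_add`) iterated, the recursion stopping because `M_{-k} = 0` for `k ≥ dim M`.
[cite: CattaniElZeinGriffithsLe2014, App. A Prop. A.3.9 (A.3.6)] [cite: Andre1996Motifs, §1.1 (Lefschetz decomposition)] -/
theorem HasLefschetzProperty.degreeSpace_neg_le_span_stringSet (L : HasLefschetzProperty h e) (k : ℕ) :
    degreeSpace h (-(k : ℤ)) ≤ Submodule.span K (stringSet h e) := by
  suffices H : ∀ n k : ℕ, Module.finrank K M ≤ k + n → degreeSpace h (-(k : ℤ)) ≤ Submodule.span K (stringSet h e) from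
    H (Module.finrank K M) k le_add_self
  intro n
  induction n with
  | zero =>
    intro k hk
    rw [L.degreeSpace_eq_bot (n := -(k : ℤ)) (by rw [abs_neg, Nat.abs_cast]; exact_mod_cast hk)]
    exact bot_le
  | succ n ih =>
    intro k hk x hx
    obtain ⟨p, hp, y, hy, rfl⟩ := L.exists_primitive_add hx
    refine Submodule.add_mem _ (Submodule.subset_span (mem_stringSet_of_mem_primitiveSpace hp))
      (apply_mem_span_stringSet (ih (k + 2) (by omega) ?_))
    have h1 : (-((k : ℤ) + 2) : ℤ) = -((k + 2 : ℕ) : ℤ) := by push_cast; ring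
    rw [h1] at hy
    exact hy

/-- Every degree part lies in the span of the strings (positive degrees: `M_k = eᵏ M_{-k}`).
[cite: LooijengaLunts1997, §1 (1.1) p. 4 L1–L2] [cite: Andre1996Motifs, §1.1] -/
theorem HasLefschetzProperty.degreeSpace_le_span_stringSet (L : HasLefschetzProperty h e) (m : ℤ) :
    degreeSpace h m ≤ Submodule.span K (stringSet h e) := by
  obtain ⟨k, rfl | rfl⟩ := Int.eq_nat_or_neg m
  · intro x hx
    obtain ⟨y, hy, rfl⟩ := (L.bijOn k).surjOn hx
    exact pow_apply_mem_span_stringSet k (L.degreeSpace_neg_le_span_stringSet k hy)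
  · exact L.degreeSpace_neg_le_span_stringSet k

/-- **The strings span `M`** (the Lefschetz decomposition, spanning half).
[cite: Andre1996Motifs, §1.1 ("la décomposition de Lefschetz : Hʲ(X) = ⊕ Lᵏ P^{j-2k}(X)")]
[cite: CattaniElZeinGriffithsLe2014, App. A Prop. A.3.9] -/
theorem HasLefschetzProperty.span_stringSet_eq_top (L : HasLefschetzProperty h e) (hgr : IsZGrading h) :
    Submodule.span K (stringSet h e) = ⊤ := by
  rw [eq_top_iff, ← hgr]
  exact iSup_le fun m ↦ L.degreeSpace_le_span_stringSet m

/-- **Extensionality on strings**: two linear maps out of `M` agreeing on every `eʲ p` (`p ∈ P_{-k}`, `j ≤ k`) are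
equal. [cite: Andre1996Motifs, §1.1 (operators defined through the Lefschetz decomposition)] -/
theorem HasLefschetzProperty.linearMap_ext_of_strings (L : HasLefschetzProperty h e) (hgr : IsZGrading h)
    {N : Type*} [AddCommGroup N] [Module K N] {f g : M →ₗ[K] N}
    (hfg : ∀ ⦃k : ℕ⦄ ⦃p : M⦄, p ∈ primitiveSpace h e k → ∀ ⦃j : ℕ⦄, j ≤ k → f ((e ^ j) p) = g ((e ^ j) p)) :
    f = g := by
  refine LinearMap.ext_on (L.span_stringSet_eq_top hgr) ?_
  rintro x ⟨k, p, j, hp, hj, rfl⟩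
  exact hfg hp hj

end Span

/-! ### §2 String-reversing operators -/

variable (h e) in
/-- **`s` reverses the strings**: `s (eʲ p) = e^{k-j} p` for `p ∈ P_{-k}`, `j ≤ k` — the defining property of the
Lefschetz involution ("`*_L x = Σ L^{d-j+k} x_{j-2k}`": on the Lefschetz component `Lᵏ x_i`, `x_i` primitive of
degree `i`, `*_L` is `L^{d-i-k} x_i`). [cite: Andre1996Motifs, §1.1 (definition of *_L, p. 10)] -/
def IsStringReversal (s : Module.End K M) : Prop :=
  ∀ ⦃k : ℕ⦄ ⦃p : M⦄, p ∈ primitiveSpace h e k → ∀ ⦃j : ℕ⦄, j ≤ k → s ((e ^ j) p) = (e ^ (k - j)) p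

/-- **Criterion**: an operator which is `eᵏ` on `M_{-k}` and inverts `eᵏ : M_{-k} → M_k` on `M_k` (the two clauses
"l'isomorphisme de Lefschetz ou son inverse" defining `*_L`) reverses the strings: for `2j ≤ k`, `eʲ p ∈ M_{-(k-2j)}`
and `s eʲ p = e^{k-2j} eʲ p`; for `2j > k`, `eʲ p = e^{2j-k} (e^{k-j} p)` with `e^{k-j} p ∈ M_{-(2j-k)}`.
[cite: Andre1996Motifs, §0.2 (p. 7) and §1.1 (p. 10)] -/
theorem isStringReversal_of_apply_eq (L : HasLefschetzProperty h e) {s : Module.End K M}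
    (h₁ : ∀ (k : ℕ) (x : M), x ∈ degreeSpace h (-(k : ℤ)) → s x = (e ^ k) x)
    (h₂ : ∀ (k : ℕ) (x : M), x ∈ degreeSpace h (-(k : ℤ)) → s ((e ^ k) x) = x) :
    IsStringReversal h e s := by
  intro k p hp j hj
  have hpk := (mem_primitiveSpace_iff.1 hp).1
  rcases le_or_gt (2 * j) k with h2j | h2j
  · -- `eʲ p ∈ M_{-(k - 2j)}`
    have hmem : (e ^ j) p ∈ degreeSpace h (-((k - 2 * j : ℕ) : ℤ)) := by
      have h1 := L.pow_apply_mem hpk j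
      convert h1 using 2
      push_cast [Nat.cast_sub h2j]
      ring
    rw [h₁ _ _ hmem, ← Module.End.mul_apply, ← pow_add]
    congr 2
    omega
  · -- `eʲ p = e^{2j-k} (e^{k-j} p)` with `e^{k-j} p ∈ M_{-(2j-k)}`
    have hmem : (e ^ (k - j)) p ∈ degreeSpace h (-((2 * j - k : ℕ) : ℤ)) := by
      have h1 := L.pow_apply_mem hpk (k - j)
      convert h1 using 2
      push_cast [Nat.cast_sub hj, Nat.cast_sub h2j.le]
      ring
    have hsplit : (e ^ j) p = (e ^ (2 * j - k)) ((e ^ (k - j)) p) := by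
      rw [← Module.End.mul_apply, ← pow_add]
      congr 2
      omega
    rw [hsplit, h₂ _ _ hmem]

/-! ### §3 The operators `N = s e s`, `eⁱ Nⁱ`, `Nᵗ eᵗ` on strings -/

namespace IsStringReversal

variable {s : Module.End K M}

/-- **`N = s e s` steps a string down**: `N (eʲ p) = eʲ⁻¹ p` for `1 ≤ j ≤ k`, and `N p = 0` (André's
`*_L L *_L`). [cite: Andre1996Motifs, Prop. 1.2 (the algebra ℚ[L, *_L L *_L])] -/
theorem conj_apply_pow_primitive (hs : IsStringReversal h e s) {k : ℕ} {p : M} (hp : p ∈ primitiveSpace h e k)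
    {j : ℕ} (hj : j ≤ k) : (s * e * s) ((e ^ j) p) = if j = 0 then 0 else (e ^ (j - 1)) p := by
  rw [Module.End.mul_apply, Module.End.mul_apply, hs hp hj, ← Module.End.mul_apply e, ← pow_succ']
  split_ifs with hj0
  · subst hj0
    rw [Nat.sub_zero, (mem_primitiveSpace_iff.1 hp).2, map_zero]
  · rw [hs hp (show k - j + 1 ≤ k by omega)]
    congr 2
    omega

/-- `Nⁱ (eʲ p) = e^{j-i} p` for `i ≤ j`, and `0` for `i > j`. [cite: Andre1996Motifs, Prop. 1.2] -/
theorem conj_pow_apply_pow_primitive (hs : IsStringReversal h e s) {k : ℕ} {p : M}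
    (hp : p ∈ primitiveSpace h e k) (i : ℕ) {j : ℕ} (hj : j ≤ k) :
    ((s * e * s) ^ i) ((e ^ j) p) = if i ≤ j then (e ^ (j - i)) p else 0 := by
  induction i generalizing j with
  | zero => rw [pow_zero, Module.End.one_apply, if_pos (Nat.zero_le _), Nat.sub_zero]
  | succ i ih =>
    rw [pow_succ, Module.End.mul_apply, hs.conj_apply_pow_primitive hp hj]
    by_cases hj0 : j = 0
    · rw [if_pos hj0, map_zero, if_neg (by omega)]
    · rw [if_neg hj0, ih (show j - 1 ≤ k by omega)]
      by_cases hij : i + 1 ≤ j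
      · rw [if_pos (by omega), if_pos hij]
        congr 2
        omega
      · rw [if_neg (by omega), if_neg hij]

/-- **`eⁱ Nⁱ` is the projector onto the string positions `≥ i`**: `eⁱ Nⁱ (eʲ p) = eʲ p` if `i ≤ j`, else `0`.
[cite: Kleiman1968AlgebraicCycles, §1.4, 1.4.4] [cite: Andre1996Motifs, Prop. 1.2] -/
theorem pow_mul_conj_pow_apply (hs : IsStringReversal h e s) {k : ℕ} {p : M} (hp : p ∈ primitiveSpace h e k)
    (i : ℕ) {j : ℕ} (hj : j ≤ k) :
    (e ^ i * (s * e * s) ^ i) ((e ^ j) p) = if i ≤ j then (e ^ j) p else 0 := by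
  rw [Module.End.mul_apply, hs.conj_pow_apply_pow_primitive hp i hj]
  split_ifs with hij
  · rw [← Module.End.mul_apply, ← pow_add]
    congr 2
    omega
  · rw [map_zero]

/-- **`Nᵗ eᵗ` is the projector onto the string positions `≥ t` from the top**: `Nᵗ eᵗ (eʲ p) = eʲ p` if
`j + t ≤ k`, else `0`. [cite: Kleiman1968AlgebraicCycles, §1.4, 1.4.4] [cite: Andre1996Motifs, Prop. 1.2] -/
theorem conj_pow_mul_pow_apply (hs : IsStringReversal h e s) {k : ℕ} {p : M} (hp : p ∈ primitiveSpace h e k)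
    (t j : ℕ) :
    ((s * e * s) ^ t * e ^ t) ((e ^ j) p) = if j + t ≤ k then (e ^ j) p else 0 := by
  rw [Module.End.mul_apply]
  split_ifs with hjt
  · rw [← Module.End.mul_apply (e ^ t), ← pow_add, hs.conj_pow_apply_pow_primitive hp t (by omega : t + j ≤ k),
      if_pos (by omega)]
    congr 2
    omega
  · rw [pow_apply_pow_primitive_of_lt hp (i := t) (j := j) (by omega), map_zero]

/-- The position projector: `(eⁱNⁱ − eⁱ⁺¹Nⁱ⁺¹)(eʲ p) = eʲ p` if `i = j`, else `0`.
[cite: Kleiman1968AlgebraicCycles, §1.4, 1.4.4] -/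
theorem posProj_apply (hs : IsStringReversal h e s) {k : ℕ} {p : M} (hp : p ∈ primitiveSpace h e k) (i : ℕ)
    {j : ℕ} (hj : j ≤ k) :
    (e ^ i * (s * e * s) ^ i - e ^ (i + 1) * (s * e * s) ^ (i + 1)) ((e ^ j) p) =
      if i = j then (e ^ j) p else 0 := by
  rw [LinearMap.sub_apply, hs.pow_mul_conj_pow_apply hp i hj, hs.pow_mul_conj_pow_apply hp (i + 1) hj]
  by_cases hij : i = j
  · rw [if_pos hij.le, if_neg (by omega), if_pos hij, sub_zero]
  · by_cases hij' : i ≤ j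
    · rw [if_pos hij', if_pos (by omega), if_neg hij, sub_self]
    · rw [if_neg hij', if_neg (by omega), if_neg hij, sub_zero]

/-- The co-position projector: `(Nᵗeᵗ − Nᵗ⁺¹eᵗ⁺¹)(eʲ p) = eʲ p` if `j + t = k`, else `0`.
[cite: Kleiman1968AlgebraicCycles, §1.4, 1.4.4] -/
theorem coposProj_apply (hs : IsStringReversal h e s) {k : ℕ} {p : M} (hp : p ∈ primitiveSpace h e k)
    (t j : ℕ) :
    ((s * e * s) ^ t * e ^ t - (s * e * s) ^ (t + 1) * e ^ (t + 1)) ((e ^ j) p) =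
      if j + t = k then (e ^ j) p else 0 := by
  rw [LinearMap.sub_apply, hs.conj_pow_mul_pow_apply hp t j, hs.conj_pow_mul_pow_apply hp (t + 1) j]
  by_cases hjt : j + t = k
  · rw [if_pos hjt.le, if_neg (by omega), if_pos hjt, sub_zero]
  · by_cases hjt' : j + t ≤ k
    · rw [if_pos hjt', if_pos (by omega), if_neg hjt, sub_self]
    · rw [if_neg hjt', if_neg (by omega), if_neg hjt, sub_zero]

end IsStringReversal

/-! ### §4 Kleiman's polynomial for `ᶜΛ` -/

variable (e) in
/-- **Kleiman's non-commutative polynomial in `e` and `N = s e s`**: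
`Σ_{i ≤ D} Σ_{t ≤ D} i(t+1) · N ∘ (eⁱNⁱ − eⁱ⁺¹Nⁱ⁺¹) ∘ (Nᵗeᵗ − Nᵗ⁺¹eᵗ⁺¹)` — on the string vector `eʲ p`
(`p ∈ P_{-k}`, `j, k - j ≤ D`) it is `j(k - j + 1) eʲ⁻¹ p`, André's `ᶜΛ (Lᵏ x_i) = k(d - i - k + 1) Lᵏ⁻¹ x_i`.
[cite: Andre1996Motifs, §1.1 (formula for ᶜΛ) and Prop. 1.2] [cite: Kleiman1968AlgebraicCycles, §1.4, 1.4.4] -/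
def kleimanDual (s : Module.End K M) (D : ℕ) : Module.End K M :=
  ∑ i ∈ Finset.range (D + 1), ∑ t ∈ Finset.range (D + 1),
    ((i * (t + 1) : ℕ) : K) •
      ((s * e * s) * (e ^ i * (s * e * s) ^ i - e ^ (i + 1) * (s * e * s) ^ (i + 1)) *
        ((s * e * s) ^ t * e ^ t - (s * e * s) ^ (t + 1) * e ^ (t + 1)))

/-- Kleiman's polynomial lies in the subalgebra generated by `e` and `s e s`.
[cite: Andre1996Motifs, Prop. 1.2 (ℚ[L, *_L L *_L])] -/
theorem kleimanDual_mem_adjoin (s : Module.End K M) (D : ℕ) :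
    kleimanDual e s D ∈ Algebra.adjoin K ({e, s * e * s} : Set (Module.End K M)) := by
  set A := Algebra.adjoin K ({e, s * e * s} : Set (Module.End K M))
  have he : e ∈ A := Algebra.subset_adjoin (Set.mem_insert _ _)
  have hN : s * e * s ∈ A := Algebra.subset_adjoin (Set.mem_insert_of_mem _ rfl)
  refine Subalgebra.sum_mem _ fun i _ ↦ Subalgebra.sum_mem _ fun t _ ↦ Subalgebra.smul_mem _ ?_ _
  refine Subalgebra.mul_mem _ (Subalgebra.mul_mem _ hN (Subalgebra.sub_mem _ ?_ ?_)) (Subalgebra.sub_mem _ ?_ ?_)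
  · exact Subalgebra.mul_mem _ (Subalgebra.pow_mem _ he _) (Subalgebra.pow_mem _ hN _)
  · exact Subalgebra.mul_mem _ (Subalgebra.pow_mem _ he _) (Subalgebra.pow_mem _ hN _)
  · exact Subalgebra.mul_mem _ (Subalgebra.pow_mem _ hN _) (Subalgebra.pow_mem _ he _)
  · exact Subalgebra.mul_mem _ (Subalgebra.pow_mem _ hN _) (Subalgebra.pow_mem _ he _)

/-- **Kleiman's polynomial on a string**: for `p ∈ P_{-k}` with `k ≤ D` and `j ≤ k`,
`kleimanDual e s D (eʲ p) = j(k - j + 1) · eʲ⁻¹ p` (`= 0` for `j = 0`).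
[cite: Andre1996Motifs, §1.1 (ᶜΛ x = Σ k(d-j+k+1) L^{k-1} x_{j-2k})] -/
theorem IsStringReversal.kleimanDual_apply_pow_primitive {s : Module.End K M} (hs : IsStringReversal h e s)
    {D k : ℕ} (hkD : k ≤ D) {p : M} (hp : p ∈ primitiveSpace h e k) {j : ℕ} (hj : j ≤ k) :
    kleimanDual e s D ((e ^ j) p) =
      if j = 0 then 0 else ((j * (k - j + 1) : ℕ) : K) • (e ^ (j - 1)) p := by
  have hterm : ∀ i t : ℕ,
      (((i * (t + 1) : ℕ) : K) •
        ((s * e * s) * (e ^ i * (s * e * s) ^ i - e ^ (i + 1) * (s * e * s) ^ (i + 1)) *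
          ((s * e * s) ^ t * e ^ t - (s * e * s) ^ (t + 1) * e ^ (t + 1)))) ((e ^ j) p) =
        if i = j ∧ j + t = k then ((i * (t + 1) : ℕ) : K) • (s * e * s) ((e ^ j) p) else 0 := by
    intro i t
    rw [LinearMap.smul_apply, Module.End.mul_apply, Module.End.mul_apply, hs.coposProj_apply hp t j]
    by_cases hjt : j + t = k
    · rw [if_pos hjt, hs.posProj_apply hp i hj]
      by_cases hij : i = j
      · rw [if_pos hij, if_pos ⟨hij, hjt⟩]
      · rw [if_neg hij, map_zero, smul_zero, if_neg (fun h' ↦ hij h'.1)]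
    · rw [if_neg hjt, map_zero, map_zero, smul_zero, if_neg (fun h' ↦ hjt h'.2)]
  rw [kleimanDual, LinearMap.sum_apply]
  simp_rw [LinearMap.sum_apply, hterm]
  rw [Finset.sum_eq_single j, Finset.sum_eq_single (k - j)]
  · rw [if_pos ⟨rfl, by omega⟩, hs.conj_apply_pow_primitive hp hj]
    split_ifs with hj0
    · rw [smul_zero]
    · rfl
  · intro t _ ht
    rw [if_neg (fun h' ↦ ht (by omega))]
  · intro hkj
    exact absurd (Finset.mem_range.2 (by omega)) hkj
  · intro i _ hi
    refine Finset.sum_eq_zero fun t _ ↦ ?_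
    rw [if_neg (fun h' ↦ hi h'.1)]
  · intro hjD
    exact absurd (Finset.mem_range.2 (by omega)) hjD

namespace HasLefschetzProperty

variable [CharZero K] [FiniteDimensional K M]

/-- **`ᶜΛ = f` is Kleiman's polynomial** (with `D = dim M`): both sides agree on every string vector — `f` by
André's formula `dual_apply_pow_primitive`, the polynomial by `kleimanDual_apply_pow_primitive` (strings of
length `> dim M` are zero) — and the strings span. [cite: Andre1996Motifs, §1.1–1.2 and Prop. 1.2]
[cite: Kleiman1968AlgebraicCycles, §1.4, 1.4.4–1.4.6] -/
theorem dual_eq_kleimanDual (L : HasLefschetzProperty h e) (hgr : IsZGrading h) {s : Module.End K M}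
    (hs : IsStringReversal h e s) : L.dual hgr = kleimanDual e s (Module.finrank K M) := by
  refine L.linearMap_ext_of_strings hgr fun k p hp j hj ↦ ?_
  by_cases hk : Module.finrank K M ≤ k
  · -- strings of length `> dim M` vanish
    have hp0 : p = 0 := by
      have hbot := L.degreeSpace_eq_bot (n := -(k : ℤ)) (by rw [abs_neg, Nat.abs_cast]; exact_mod_cast hk)
      have h1 := (mem_primitiveSpace_iff.1 hp).1
      rwa [hbot, Submodule.mem_bot] at h1
    rw [hp0, map_zero, map_zero, map_zero]
  rw [hs.kleimanDual_apply_pow_primitive (le_of_lt (not_le.1 hk)) hp hj]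
  rcases j with _ | j
  · rw [if_pos rfl, pow_zero, Module.End.one_apply, L.dual_apply_primitive hgr hp]
  · rw [if_neg (Nat.succ_ne_zero j), L.dual_apply_pow_primitive hgr hp j, Nat.add_sub_cancel]
    congr 1
    have h1 : ((k - (j + 1) + 1 : ℕ) : ℤ) = (k : ℤ) - j := by omega
    rw [← Int.cast_natCast ((j + 1) * (k - (j + 1) + 1)), Nat.cast_mul, h1]
    push_cast
    ring

/-- **Kleiman 1968, 1.4.4 / André 1996, Prop. 1.2 (abstract form): the `𝔰𝔩₂`-partner `f` of a Lefschetz operator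
`e` lies in the subalgebra `K[e, s e s]` of `End M`, for every string-reversing `s`** ("`ℚ[L, *_L L *_L] = ℚ[L, ᶜΛ]`",
the inclusion `⊇`). [cite: Andre1996Motifs, Prop. 1.2 (p. 11)] [cite: Kleiman1968AlgebraicCycles, §1.4, 1.4.4] -/
theorem dual_mem_adjoin_conj (L : HasLefschetzProperty h e) (hgr : IsZGrading h) {s : Module.End K M}
    (hs : IsStringReversal h e s) : L.dual hgr ∈ Algebra.adjoin K ({e, s * e * s} : Set (Module.End K M)) := by
  rw [L.dual_eq_kleimanDual hgr hs]
  exact kleimanDual_mem_adjoin s _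

/-- **… hence in the subalgebra `K[e, s]`** ("`ℚ[L, *_L] = ℚ[L, ᶜΛ]`", the inclusion `⊇`).
[cite: Andre1996Motifs, Prop. 1.2 (p. 11)] [cite: Kleiman1968AlgebraicCycles, §1.4, 1.4.4–1.4.5] -/
theorem dual_mem_adjoin (L : HasLefschetzProperty h e) (hgr : IsZGrading h) {s : Module.End K M}
    (hs : IsStringReversal h e s) : L.dual hgr ∈ Algebra.adjoin K ({e, s} : Set (Module.End K M)) := by
  refine Algebra.adjoin_le ?_ (L.dual_mem_adjoin_conj hgr hs)
  have he : e ∈ Algebra.adjoin K ({e, s} : Set (Module.End K M)) := Algebra.subset_adjoin (Set.mem_insert _ _)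
  have hs' : s ∈ Algebra.adjoin K ({e, s} : Set (Module.End K M)) :=
    Algebra.subset_adjoin (Set.mem_insert_of_mem _ rfl)
  rintro x (rfl | rfl)
  · exact he
  · exact Subalgebra.mul_mem _ (Subalgebra.mul_mem _ hs' he) hs'

end HasLefschetzProperty

end Literature.Algebra.Lie

end
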